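import Summits.RiemannHypothesis.RiemannHypothesis.Theses.RuelleBand
import Summits.RiemannHypothesis.RiemannHypothesis.Theorems.ZetaWeakRecurrence.Negative.Calibration
import Summits.RiemannHypothesis.RiemannHypothesis.Theorems.RuelleBandNribWeakRecurrenceToExact
import Literature.NumberTheory.LFunctions.ZetaUniversalityDiscMain
import Literature.Barriers.RiemannHypothesis.BohrDenseValuesProofs
import Literature.Barriers.RiemannHypothesis.BohrDenseValuesVoronin
import HarnessLib

/-!
# Disproof of `ZetaWeakRecurrence` (stmt-RiemannHypothesis-18110, route RuelleBand) — crux disprover's work file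

Cycle 1 (refuter-cdisprove-stmt-RiemannHypothesis-18110-0, 2026-08-17). Everything below is kernel-checked
(rc 0, 0 sorry) unless it sits in a comment. WR := the crux:

  `∀ z r, 0 < r → r < min (Re z − 1/2) (1 − Re z) → ∀ ε > 0, ∀ T, ∃ τ ≥ T, ∀ s ∈ closedBall z r,
     ‖ζ(s + iτ) − ζ(s)‖ < ε`.

## Findings (index)

§0 CALIBRATION (tree, prior seat): `RH → WR`, hence `¬WR → ¬RH`
   (`Theorems/ZetaWeakRecurrence/Negative/Calibration.lean`, `not_riemannHypothesis_of_not_zetaWeakRecurrence`).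
   CONSEQUENCE FOR THIS LANE: no unconditional `¬WR` can be landed short of disproving RH; a numerical
   counterexample would need an off-line zero (none below height 3·10¹²). The disprover's output is therefore
   LOAD-BEARING / RIGIDITY / TIGHTNESS theorems, not a kill.

§1 LOAD-BEARING ANALYSIS of the four hypotheses of WR (each as a theorem):
   * `0 < r` — NOT load-bearing: `zetaWeakRecurrenceWithoutPos_iff` (dropping it gives an EQUIVALENT statement;
     `r < 0` is the empty disc, `r = 0` is POINTWISE recurrence, which is a THEOREM at every point of the open
     strip, zeros included: `pointwise_recurrence`, from the tree's Voronin denseness). MORAL: the open content of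
     WR is UNIFORMITY on a disc about a hypothetical off-line zero, never recurrence of individual values.
   * right edge `r < 1 − Re z` — load-bearing for a DEGENERATE reason: `zetaWeakRecurrence_false_without_rightEdge`
     (a disc containing the pole `s = 1` never recurs: `ζ` is unbounded near `1`, each shifted copy is bounded).
     Discs of `{Re s > 1/2}` avoiding the pole but crossing `Re s = 1` are EXPECTED to recur (almost periodicity
     on `Re s > 1` + universality inside) — not typed, not in print in this exact form.
   * left edge `r < Re z − 1/2` — load-bearing for an HONEST reason (growth): `zetaWeakRecurrence_false_without_leftEdge`
     (witness disc `|s + 1| ≤ 1`; `|ζ(−1 + iτ)| ≥ 2` for all `τ ≥ 30`, `two_le_norm_zeta_neg_one_add`, proved from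
     EXACT identities only: functional equation at `2 − iτ`, `|Γ(1 − iτ)|² sinh(πτ) = πτ`, `cos(π − x) = −cos x`,
     `cosh²(x/2) ≥ sinh(x)/2`, `|ζ(2 − iτ)| ≥ 2 − π²/6 > 1/3`). SHARP FORM NOT CLAIMED: "WR fails on every disc
     meeting `{Re s < 1/2}`" needs `|χ(σ+iτ)| ≍ τ^{1/2−σ}` (Stirling) AND `max_disc |ζ(1 − s − iτ)| ≥ τ^{−o(1)}`
     for ALL large `τ`; unconditionally only a two-constants bound `τ^{−A}` is available (ζ may be uniformly tiny
     on a disc for sparse τ — universality with small constant targets), so near the line this tightness is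
     itself RH-flavoured. Far left (this theorem) it is unconditional.
   * lateness `T ≤ τ` — carries EVERYTHING, but RIGIDLY: without it the statement is trivial
     (`recurrence_without_lateness_trivial`, `τ = 0`); with ANY fixed positive threshold it is already the
     full crux: `zetaWeakRecurrence_iff_oneLateReturn` (ONE return at height `≥ 1` per disc and per `ε` ⟺ WR).
     Engine: `eq_zero_of_shift_eq_on_disc` — `ζ` has NO vertical period on any disc of `{Re s < 1}` (identity
     theorem on `ℂ ∖ {1, 1 − iτ}`, then the pole at `1` against continuity at `1 + iτ`); returns trapped below
     a height for all `ε` would accumulate at an exact period (compactness of `[1, T₀]`).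
     READING FOR PROVERS: WR ⟺ "`ζ|_D` is NOT ISOLATED in `{ζ(·+iτ)|_D : τ ≥ 1}` for the sup norm" — a
     closure statement about ONE orbit tail; no infinitude, no density, no height bookkeeping is needed.

§2 TIGHTNESS / NATURAL STRENGTHENINGS:
   * `∃ τ ∀ ε` (exact period): FALSE — `eq_zero_of_shift_eq_on_disc`.
   * positive LOWER density of returns: ⟺ RH (tree `riemannHypothesis_iff_strongRecurrence_of_Voronin`, proved).
   * positive UPPER density (Bagchi's ORIGINAL form — Sourmelidis arXiv:2308.07031 §2: "Bagchi proves only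
     (1) ⟺ (3)", (3) = the limsup form): ⟺ RH as well, NOW KERNEL-CHECKED in
     `Theorems/ZetaWeakRecurrence/Negative/DensityScale.lean` (`riemannHypothesis_iff_upperRecurrence`,
     via `not_posUpperDensity_of_generated_zeros`: the Rouché/zero-density counting works at EVERY large
     height; proposal p142868) — every ASYMPTOTIC-density strengthening is RH verbatim.
   * positive upper BANACH density (WR⁺): open, `RH ↔ ZB ∧ WR⁺` (SketchIdeator1) — not attackable.
   * one `τ` serving ALL discs at once: FALSE, but only through the pole at `1 − iτ` entering discs of height
     `≈ −τ` (degenerate; for discs in a bounded height window it is Bagchi's compact-set recurrence, RH-implied).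
   * integer shifts `τ ∈ ℕ` (what SketchIdeator1's unit-shift transfer `(M) → WR` actually produces):
     RH-implied via Reich's discrete universality (Steuding p.138; NOT in tree) — not attackable.
   * UNIFORM (syndetic) recurrence "∀ ε ∃ L ∀ base height t₀ ∃ τ ∈ [1, L] returning `ζ(·+it₀)|_D`": expected
     FALSE unconditionally (target `g(s) = s − z + 2r` on the stadium `D + i[0, L+1]`: `|g(·+iτ) − g| = τ ≥ 1`
     while `ζ(·+it₀) ≈ g` there for some `t₀`) — but the proof needs universality on a NON-DISC compact set
     (Mergelyan form of Voronin/Bagchi), and the tree holds only the disc case `Steuding2007_thm1_9_discAnalytic`;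
     not typed. (For `L(s,χ)` Bohr's theorem says the syndetic form is exactly GRH.)

§3 WHAT ANY PROOF OF WR PROVES: `cofiniteToExact_of_zetaWeakRecurrence : WR → CofiniteToExact` (the route's
   open glue rung = Bombieri's zero-or-infinity dichotomy; two lines from the tree's Rouché glue
   `exactFirstBand_of_noRightInteriorBand_of_weakRecurrence` and `Cofinite → NRIB`). So WR is at least as
   strong as ZOI; it is not known to be RH-equivalent (probes WR → X fail, prior seat).

§4 TARGETS (lead's registered skeleton `Lines/Sketch.lean`, sha 77d5c826…; `payload.targets = []` this cycle):
   * `stub_recurrence_of_approximant` — TRUE and not misstated: PROVED below verbatim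
     (`stub_recurrence_of_approximant_holds`, disc universality at the target `g`, 15 lines) — the lead may
     paste it.
   * `stub_approximant_of_noInteriorZero` — TRUE and not misstated: PROVED below verbatim
     (`stub_approximant_of_noInteriorZero_holds`, contraction `ζ(z + (1−θ)(s−z))` + uniform continuity, 60 lines).
     HENCE THE LINE'S ONLY OPEN CONTENT IS `stub_roucheRegime` (both other stubs kernel-checked here; the file
     `StubProofs.lean` with the two proofs under the skeleton's own names is attached to the item for the lead).
   * `stub_roucheRegime` — the open residue. Vacuous under RH (no interior zero), hence RH-implied and NOT
     killable unconditionally (§0). Its hypotheses are jointly satisfiable only in a `¬RH` world. Under them every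
     `ε`-return generates a zero within `δ` of `ξ + iτ` (tree `exists_zero_near_shift`), so the stub asserts
     "replicated off-line zeros above every height near `Re ξ`" PLUS value-closeness; the first half alone is
     already open. The composition `ZetaWeakRecurrence_of` is gap-free (case split on the approximant). 0 broken.

§5 ATTACKS THAT CANNOT WORK (so nobody repeats them): finite models / `decide` (no finite content); kit numerics
   (a witness needs an off-line zero); literature negatives (`ledger negatives`: none on recurrence; Steuding
   Thm 8.3 / Bagchi: only density forms are RH-equivalent; Pańkowski 2016: d-self-approximation is open exactly
   at d ∈ {0,1}); barrier catalogue (`BohrDenseValues*`: denseness/universality are the POSITIVE inputs here;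
   `BeurlingCounterexamples`: WR-shape fails for Beurling zetas with finitely many planted off-line zeros — an
   abstract-model negative showing a proof must use the exact Euler product, cf. BarrierNotes-r1-k2 §B1; not
   typed this cycle, the tree's BDR template is heavy); hypothesis mutation: done in §1.

## Landing (Negative/ lane, `--supports stmt-RiemannHypothesis-18110`)
`Theorems/ZetaWeakRecurrence/Negative/LoadBearing.lean` (pointwise, without-pos iff, right edge),
`…/Negative/LeftEdgeGrowth.lean` (Γ-reflection norm, ζ on `Re s = 2`, growth at `−1 + iτ`, left edge),
`…/Negative/Rigidity.lean` (no vertical period, one-late-return iff) — ALL THREE ACCEPTED 2026-08-17T05:06Z: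
p142638 (LoadBearing), p142640 (LeftEdgeGrowth), p142641 (Rigidity); plus `…/Negative/DensityScale.lean`
(upper-density recurrence ⟺ RH; p142868 ACCEPTED); importable as
`Summits.RiemannHypothesis.RiemannHypothesis.Theorems.ZetaWeakRecurrence.Negative.{LoadBearing,LeftEdgeGrowth,Rigidity,DensityScale}`.

## Literature check (this seat)
Matsumoto, "A survey on the theory of universality for zeta and L-functions" (arXiv:1407.4216) §9, Thm 20 READ:
Bagchi's theorem is stated with the POSITIVE-LOWER-DENSITY return set (9-1) only; Remark 8: for Dirichlet
`L(s,χ)`, χ non-principal, Bohr 1922 proved GRH ⟺ ALMOST PERIODICITY in `Re s > 1/2` (syndetic returns — far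
stronger than WR). Bagchi 1987 (Acta Math. Hung. 50, doi:10.1007/bf01903937, "Recurrence in topological
dynamics and the RH") is paywalled: acquisition request acq-06685 (open) — the one place where a density-free
recurrence statement might be printed; the grounder's reading of Steuding pp.136–141 and Matsumoto's survey both
give only the density form. `ledger negatives --problem RiemannHypothesis`: nothing on recurrence.
-/

set_option linter.dupNamespace false

noncomputable section

open Complex Set Metric Filter Topology

namespace Summit.RiemannHypothesis.RiemannHypothesis.Cruxes.ZetaWeakRecurrence.Disproof

open Summit.RiemannHypothesis.RiemannHypothesis.Theses.RuelleBand
open Literature.Barriers.RiemannHypothesis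

/-! ## §1a  `0 < r` is decoration; pointwise recurrence is a theorem -/

/-- POINTWISE recurrence is a THEOREM at every point of the open strip — including at a
hypothetical off-line zero (Voronin/Bohr denseness of the tail of every line, tree
`exists_mem_of_isOpen` + `Voronin1975_universality_holds`). -/
theorem pointwise_recurrence {z : ℂ} (hz : 1 / 2 < z.re) (hz' : z.re < 1) {ε : ℝ} (hε : 0 < ε)
    (T : ℝ) : ∃ τ : ℝ, T ≤ τ ∧ ‖riemannZeta (z + τ * I) - riemannZeta z‖ < ε := by
  obtain ⟨t, ht, hmem⟩ := exists_mem_of_isOpen Voronin1975_universality_holds hz hz'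
    Metric.isOpen_ball ⟨riemannZeta z, Metric.mem_ball_self hε⟩ (T + z.im)
  refine ⟨t - z.im, by linarith, ?_⟩
  have : z + ((t - z.im : ℝ) : ℂ) * I = (z.re : ℂ) + (t : ℂ) * I := by
    apply Complex.ext <;> simp
  rw [this, ← dist_eq_norm]
  exact hmem

/-- WR with the hypothesis `0 < r` DROPPED. -/
def ZetaWeakRecurrenceWithoutPos : Prop :=
  ∀ (z : ℂ) (r : ℝ), r < min (z.re - 1 / 2) (1 - z.re) → ∀ ε : ℝ, 0 < ε → ∀ T : ℝ, ∃ τ : ℝ, T ≤ τ ∧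
    ∀ s ∈ Metric.closedBall z r, ‖riemannZeta (s + ↑τ * Complex.I) - riemannZeta s‖ < ε

/-- `0 < r` is NOT load-bearing: dropping it gives an EQUIVALENT statement (`r < 0`: empty disc;
`r = 0`: pointwise recurrence, a theorem). -/
theorem zetaWeakRecurrenceWithoutPos_iff : ZetaWeakRecurrenceWithoutPos ↔ ZetaWeakRecurrence := by
  refine ⟨fun h z r _ hr => h z r hr, fun h z r hr ε hε T => ?_⟩
  rcases lt_trichotomy r 0 with hneg | rfl | hpos
  · refine ⟨T, le_rfl, fun s hs => ?_⟩
    rw [Metric.closedBall_eq_empty.2 hneg] at hs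
    exact absurd hs (Set.notMem_empty s)
  · have hz : 1 / 2 < z.re := by have := hr.trans_le (min_le_left _ _); linarith
    have hz' : z.re < 1 := by have := hr.trans_le (min_le_right _ _); linarith
    obtain ⟨τ, hτ, hlt⟩ := pointwise_recurrence hz hz' hε T
    refine ⟨τ, hτ, fun s hs => ?_⟩
    rw [Metric.closedBall_zero, Set.mem_singleton_iff] at hs
    subst hs
    exact hlt
  · exact h z r hpos hr ε hε T

/-- WR with the RIGHT-EDGE hypothesis `r < 1 - Re z` DROPPED (discs anywhere in `Re s > 1/2`). -/
def ZetaWeakRecurrenceWithoutRightEdge : Prop :=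
  ∀ (z : ℂ) (r : ℝ), 0 < r → r < z.re - 1 / 2 → ∀ ε : ℝ, 0 < ε → ∀ T : ℝ, ∃ τ : ℝ, T ≤ τ ∧
    ∀ s ∈ Metric.closedBall z r, ‖riemannZeta (s + ↑τ * Complex.I) - riemannZeta s‖ < ε

/-- The right-edge hypothesis is load-bearing, but for a DEGENERATE reason: a disc containing the
pole `s = 1` never recurs (`ζ` is unbounded near `1`, every shifted copy is bounded on the disc).
Witness `z = 1`, `r = 1/4`, `ε = 1`, `T = 1`. -/
theorem zetaWeakRecurrence_false_without_rightEdge : ¬ ZetaWeakRecurrenceWithoutRightEdge := by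
  intro h
  obtain ⟨τ, hτ, hret⟩ := h 1 (1 / 4) (by norm_num) (by norm_num) 1 one_pos 1
  -- the shifted copy is bounded on the disc
  have hcont : ContinuousOn (fun s : ℂ => riemannZeta (s + τ * I)) (closedBall (1 : ℂ) (1 / 4)) := by
    intro s hs
    have hs1 : s + τ * I ≠ 1 := by
      intro h1
      have him := congrArg Complex.im h1
      simp only [add_im, mul_im, ofReal_re, I_im, mul_one, ofReal_im, I_re, mul_zero, add_zero,
        one_im] at him
      rw [mem_closedBall, dist_eq_norm] at hs
      have h2 := (abs_im_le_norm (s - 1)).trans hs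
      rw [sub_im, one_im, sub_zero, abs_le] at h2
      linarith [h2.1]
    exact ((differentiableAt_riemannZeta hs1).comp s
      (differentiableAt_id.add_const _)).continuousAt.continuousWithinAt
  obtain ⟨M, hM⟩ := (isCompact_closedBall (1 : ℂ) (1 / 4)).exists_bound_of_continuousOn hcont
  -- `ζ s - 1/(s-1)` is bounded near `1`
  obtain ⟨c, hc⟩ := (isBigO_riemannZeta_sub_one_div (F := ℝ)).bound
  rw [Metric.eventually_nhds_iff] at hc
  obtain ⟨ρ, hρ, hc⟩ := hc
  -- a real point `1 + δ` close to the pole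
  set K : ℝ := |M| + |c| + 2 with hK
  have hKpos : 0 < K := by positivity
  set δ : ℝ := min (ρ / 2) (min (1 / 4) (1 / K)) with hδ
  have hδpos : 0 < δ := lt_min (by linarith) (lt_min (by norm_num) (by positivity))
  have hδρ : δ < ρ := (min_le_left _ _).trans_lt (by linarith)
  have hδ4 : δ ≤ 1 / 4 := (min_le_right _ _).trans (min_le_left _ _)
  have hδK : δ ≤ 1 / K := (min_le_right _ _).trans (min_le_right _ _)
  set s : ℂ := 1 + (δ : ℂ) with hsdef
  have hs1 : s - 1 = (δ : ℂ) := by rw [hsdef]; ring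
  have hnormδ : ‖(δ : ℂ)‖ = δ := by rw [norm_real, Real.norm_eq_abs, abs_of_pos hδpos]
  have hsball : s ∈ closedBall (1 : ℂ) (1 / 4) := by
    rw [mem_closedBall, dist_eq_norm, hs1, hnormδ]; exact hδ4
  have hsdist : dist s 1 < ρ := by rw [dist_eq_norm, hs1, hnormδ]; exact hδρ
  have hbig : K ≤ ‖1 / (s - 1)‖ := by
    rw [hs1, norm_div, norm_one, hnormδ]
    rw [le_div_iff₀ hδpos]
    calc K * δ ≤ K * (1 / K) := by gcongr
      _ = 1 := by field_simp
  have hnear : ‖riemannZeta s - 1 / (s - 1)‖ ≤ c * ‖(1 : ℝ)‖ := hc hsdist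
  rw [norm_one, mul_one] at hnear
  have hζs : |M| + 2 ≤ ‖riemannZeta s‖ := by
    have h1 : ‖1 / (s - 1)‖ ≤ ‖riemannZeta s‖ + ‖riemannZeta s - 1 / (s - 1)‖ := by
      calc ‖1 / (s - 1)‖ = ‖riemannZeta s - (riemannZeta s - 1 / (s - 1))‖ := by ring_nf
        _ ≤ ‖riemannZeta s‖ + ‖riemannZeta s - 1 / (s - 1)‖ := norm_sub_le _ _
    have h2 : c ≤ |c| := le_abs_self c
    linarith
  have hshift : ‖riemannZeta (s + τ * I)‖ ≤ |M| := (hM s hsball).trans (le_abs_self M)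
  have hlt := hret s hsball
  have hge : ‖riemannZeta s‖ - ‖riemannZeta (s + τ * I)‖ ≤
      ‖riemannZeta (s + τ * I) - riemannZeta s‖ := by
    have := norm_sub_norm_le (riemannZeta s) (riemannZeta (s + τ * I))
    rwa [norm_sub_rev] at this
  linarith


/-! ## §1c/§2  Lateness: trivial without it, rigid with it (no vertical period) -/

/-- Without the lateness clause `T ≤ τ` the statement is TRIVIAL (`τ = 0`). [folklore] -/
theorem recurrence_without_lateness_trivial (z : ℂ) (r : ℝ) {ε : ℝ} (hε : 0 < ε) :
    ∃ τ : ℝ, ∀ s ∈ closedBall z r, ‖riemannZeta (s + τ * I) - riemannZeta s‖ < ε :=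
  ⟨0, fun s _ => by simpa using hε⟩

/-- `ζ` has NO VERTICAL PERIOD: if `ζ(s + iτ) = ζ(s)` on a closed disc of positive radius inside
`{Re s < 1}`, then `τ = 0` (identity theorem on `ℂ ∖ {1, 1 − iτ}`, then the pole at `1` against
continuity at `1 + iτ`). [folklore] -/
theorem eq_zero_of_shift_eq_on_disc {z : ℂ} {r : ℝ} (hr : 0 < r) (hz : z.re + r < 1) {τ : ℝ}
    (h : ∀ s ∈ closedBall z r, riemannZeta (s + τ * I) = riemannZeta s) : τ = 0 := by
  by_contra hτ
  set f : ℂ → ℂ := fun w => riemannZeta (w + τ * I) - riemannZeta w with hf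
  set U : Set ℂ := ({1, 1 - τ * I} : Set ℂ)ᶜ with hU
  have hUfin : ({1, 1 - τ * I} : Set ℂ).Finite := (Set.finite_singleton _).insert 1
  have hUo : IsOpen U := hUfin.isClosed.isOpen_compl
  have hdiff : DifferentiableOn ℂ f U := by
    intro w hw
    have hw1 : w ≠ 1 := fun h1 => hw (by simp [h1])
    have hw2 : w + τ * I ≠ 1 := fun h1 => hw (by
      have : w = 1 - τ * I := by linear_combination h1
      simp [this])
    exact (((differentiableAt_riemannZeta hw2).comp w (differentiableAt_id.add_const _)).sub
      (differentiableAt_riemannZeta hw1)).differentiableWithinAt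
  have han : AnalyticOnNhd ℂ f U := hdiff.analyticOnNhd hUo
  have hpre : IsPreconnected U :=
    (Set.Countable.isPathConnected_compl_of_one_lt_rank (by simp)
      hUfin.countable).isConnected.isPreconnected
  have hzU : z ∈ U := by
    intro hz'
    rcases hz' with h1 | h2
    · have := congrArg Complex.re h1
      simp at this
      linarith
    · have := congrArg Complex.re h2
      simp at this
      linarith
  have hfreq : ∃ᶠ w in 𝓝[≠] z, f w = 0 := by
    apply Filter.Eventually.frequently
    have hev : ∀ᶠ w in 𝓝 z, f w = 0 := by
      rw [Metric.eventually_nhds_iff]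
      exact ⟨r, hr, fun w hw => sub_eq_zero.2 (h w (Metric.mem_closedBall.2 hw.le))⟩
    exact hev.filter_mono nhdsWithin_le_nhds
  have hEq := han.eqOn_zero_of_preconnected_of_frequently_eq_zero hpre hzU hfreq
  -- the pole at `1` against continuity at `1 + iτ`
  have hne : (1 : ℂ) - τ * I ≠ 1 := by
    intro h1
    have := congrArg Complex.im h1
    simp at this
    exact hτ this
  have h1U : ∀ᶠ w in 𝓝[≠] (1 : ℂ), w ∈ U := by
    have h2 : ∀ᶠ w in 𝓝 (1 : ℂ), w ≠ 1 - τ * I := eventually_ne_nhds hne.symm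
    filter_upwards [self_mem_nhdsWithin, h2.filter_mono nhdsWithin_le_nhds] with w hw1 hw2
    simp only [hU, Set.mem_compl_iff, Set.mem_insert_iff, Set.mem_singleton_iff, not_or]
    exact ⟨hw1, hw2⟩
  have hev : (fun w => (w - 1) * riemannZeta w) =ᶠ[𝓝[≠] (1 : ℂ)]
      fun w => (w - 1) * riemannZeta (w + τ * I) := by
    filter_upwards [h1U] with w hw
    have h0 : f w = 0 := hEq hw
    simp only [hf, sub_eq_zero] at h0
    rw [h0]
  have hlim1 : Tendsto (fun w => (w - 1) * riemannZeta w) (𝓝[≠] 1) (𝓝 1) :=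
    riemannZeta_residue_one
  have h1τ : (1 : ℂ) + τ * I ≠ 1 := by
    intro h1
    have := congrArg Complex.im h1
    simp at this
    exact hτ this
  have hlim2 : Tendsto (fun w => (w - 1) * riemannZeta (w + τ * I)) (𝓝[≠] (1 : ℂ)) (𝓝 0) := by
    have hc1 : ContinuousAt (fun w : ℂ => riemannZeta (w + τ * I)) 1 :=
      ((differentiableAt_riemannZeta h1τ).comp 1 (differentiableAt_id.add_const _)).continuousAt
    have hc : ContinuousAt (fun w : ℂ => (w - 1) * riemannZeta (w + τ * I)) 1 :=
      (continuousAt_id.sub continuousAt_const).mul hc1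
    have := hc.tendsto
    simp only [sub_self, zero_mul] at this
    exact this.mono_left nhdsWithin_le_nhds
  exact one_ne_zero (tendsto_nhds_unique_of_eventuallyEq hlim1 hlim2 hev)

/-- RIGIDITY OF THE HEIGHT QUANTIFIER: WR is equivalent to asking, for each disc and each `ε`,
for ONE return at ANY height `≥ 1` (a fixed positive threshold). Reason: returns trapped below a
height `T₀` for all `ε` would accumulate (compactness of `[1, T₀]`) at an EXACT vertical period of
`ζ` on the disc, excluded by `eq_zero_of_shift_eq_on_disc`. So WR says exactly: "`ζ|_D` lies in the
sup-norm closure of `{ζ(· + iτ)|_D : τ ≥ 1}`" — one non-trivial approximate return per `ε`. -/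
theorem zetaWeakRecurrence_iff_oneLateReturn :
    ZetaWeakRecurrence ↔ ∀ (z : ℂ) (r : ℝ), 0 < r → r < min (z.re - 1 / 2) (1 - z.re) →
      ∀ ε : ℝ, 0 < ε → ∃ τ : ℝ, 1 ≤ τ ∧
        ∀ s ∈ closedBall z r, ‖riemannZeta (s + τ * I) - riemannZeta s‖ < ε := by
  refine ⟨fun h z r hr hrmin ε hε => h z r hr hrmin ε hε 1, fun h z r hr hrmin ε hε T => ?_⟩
  by_contra hcon
  push Not at hcon
  have hz1 : z.re + r < 1 := by
    have := hrmin.trans_le (min_le_right _ _); linarith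
  -- returns at level `min ε (1/(n+1))`, all trapped in `[1, T]`
  have hret : ∀ n : ℕ, ∃ τ : ℝ, 1 ≤ τ ∧ τ ≤ T ∧
      ∀ s ∈ closedBall z r, ‖riemannZeta (s + τ * I) - riemannZeta s‖ < 1 / ((n : ℝ) + 1) := by
    intro n
    obtain ⟨τ, hτ1, hτ⟩ := h z r hr hrmin (min ε (1 / ((n : ℝ) + 1))) (lt_min hε (by positivity))
    refine ⟨τ, hτ1, ?_, fun s hs => (hτ s hs).trans_le (min_le_right _ _)⟩
    by_contra hT
    push Not at hT
    obtain ⟨s, hs, hle⟩ := hcon τ hT.le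
    exact absurd ((hτ s hs).trans_le (min_le_left _ _)) (not_lt.2 hle)
  choose τ hτ1 hτT hτret using hret
  obtain ⟨τ₀, hτ₀mem, φ, hφ, hlim⟩ :=
    isCompact_Icc.tendsto_subseq (fun n => (⟨hτ1 n, hτT n⟩ : τ n ∈ Icc (1 : ℝ) T))
  -- the limit shift is an exact period of `ζ` on the disc
  have hperiod : ∀ s ∈ closedBall z r, riemannZeta (s + τ₀ * I) = riemannZeta s := by
    intro s hs
    have hs1 : ∀ t : ℝ, s + t * I ≠ 1 := by
      intro t h1
      have := congrArg Complex.re h1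
      simp at this
      rw [mem_closedBall, dist_eq_norm] at hs
      have h2 := (abs_re_le_norm (s - z)).trans hs
      rw [sub_re, abs_le] at h2
      linarith [h2.2]
    have hg : Continuous fun t : ℝ => riemannZeta (s + t * I) := by
      refine continuous_iff_continuousAt.2 fun t => ?_
      have hc : Continuous fun t : ℝ => s + (t : ℂ) * I := by fun_prop
      exact ContinuousAt.comp (g := riemannZeta) (f := fun t : ℝ => s + (t : ℂ) * I)
        (differentiableAt_riemannZeta (hs1 t)).continuousAt hc.continuousAt
    have hlim1 : Tendsto (fun n => ‖riemannZeta (s + τ (φ n) * I) - riemannZeta s‖) atTop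
        (𝓝 ‖riemannZeta (s + τ₀ * I) - riemannZeta s‖) :=
      (((hg.tendsto τ₀).comp hlim).sub_const (riemannZeta s)).norm
    have hlim0 : Tendsto (fun n => ‖riemannZeta (s + τ (φ n) * I) - riemannZeta s‖) atTop
        (𝓝 0) := by
      refine squeeze_zero (fun n => norm_nonneg _) (fun n => (hτret (φ n) s hs).le) ?_
      exact tendsto_one_div_add_atTop_nhds_zero_nat.comp hφ.tendsto_atTop
    have := tendsto_nhds_unique hlim1 hlim0
    rwa [norm_eq_zero, sub_eq_zero] at this
  have h0 := eq_zero_of_shift_eq_on_disc hr hz1 hperiod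
  have h1 : (1 : ℝ) ≤ τ₀ := hτ₀mem.1
  linarith


/-! ## §1b  The left edge: growth of `ζ` left of the critical strip, from exact identities -/

/-- EXACT reflection identity `|Γ(1 − iτ)|² sinh(πτ) = πτ` (`Γ(z)Γ(1−z) = π / sin(πz)` at
`z = iτ`, `Γ(1 − iτ) = −iτ Γ(−iτ)`, `Γ(conj z) = conj Γ(z)`). [folklore] -/
theorem norm_Gamma_one_sub_mul_I_sq {τ : ℝ} (hτ : 0 < τ) :
    ‖Gamma (1 - τ * I)‖ ^ 2 * Real.sinh (Real.pi * τ) = Real.pi * τ := by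
  set w : ℂ := τ * I with hw
  have hw0 : w ≠ 0 := mul_ne_zero (ofReal_ne_zero.2 hτ.ne') I_ne_zero
  have hsinh : 0 < Real.sinh (Real.pi * τ) := Real.sinh_pos_iff.2 (by positivity)
  -- reflection formula, in norm
  have hrefl := Complex.Gamma_mul_Gamma_one_sub w
  have hsin : Complex.sin (↑Real.pi * w) = (Real.sinh (Real.pi * τ) : ℂ) * I := by
    rw [hw, ← mul_assoc, show (↑Real.pi * ↑τ : ℂ) = ((Real.pi * τ : ℝ) : ℂ) by push_cast; ring,
      Complex.sin_mul_I, ← Complex.ofReal_sinh]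
  rw [hsin] at hrefl
  have hnorm1 : ‖Gamma w‖ * ‖Gamma (1 - w)‖ = Real.pi / Real.sinh (Real.pi * τ) := by
    rw [← norm_mul, hrefl, norm_div, norm_mul, norm_real, norm_real, norm_I, mul_one,
      Real.norm_of_nonneg Real.pi_pos.le, Real.norm_of_nonneg hsinh.le]
  -- `Γ(1 - w) = (-w) Γ(-w)` and `|Γ(-w)| = |Γ(w)|`
  have hshift : Gamma (1 - w) = -w * Gamma (-w) := by
    rw [show (1 : ℂ) - w = -w + 1 by ring, Complex.Gamma_add_one _ (neg_ne_zero.2 hw0)]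
  have hconj : (starRingEnd ℂ) w = -w := by
    rw [hw, map_mul, Complex.conj_ofReal, Complex.conj_I]; ring
  have hnormneg : ‖Gamma (-w)‖ = ‖Gamma w‖ := by
    rw [← hconj, Complex.Gamma_conj, Complex.norm_conj]
  have hnormw : ‖w‖ = τ := by
    rw [hw, norm_mul, norm_real, norm_I, mul_one, Real.norm_of_nonneg hτ.le]
  have hnorm2 : ‖Gamma (1 - w)‖ = τ * ‖Gamma w‖ := by
    rw [hshift, norm_mul, norm_neg, hnormneg, hnormw]
  -- combine
  have hG : ‖Gamma w‖ = ‖Gamma (1 - w)‖ / τ := by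
    rw [hnorm2]; field_simp
  rw [hG] at hnorm1
  field_simp at hnorm1
  rw [mul_comm Real.pi τ]
  linarith [hnorm1]

/-- On the line `Re s = 2`: `|ζ(s) − 1| ≤ ζ(2) − 1 = π²/6 − 1`. [folklore] -/
theorem norm_zeta_sub_one_le {s : ℂ} (hs : s.re = 2) :
    ‖riemannZeta s - 1‖ ≤ Real.pi ^ 2 / 6 - 1 := by
  have hs1 : 1 < s.re := by rw [hs]; norm_num
  have hs0 : s ≠ 0 := by
    intro h; rw [h, zero_re] at hs; norm_num at hs
  rw [zeta_eq_tsum_one_div_nat_cpow hs1]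
  set f : ℕ → ℂ := fun n => 1 / (n : ℂ) ^ s with hf
  have hnorm : ∀ n : ℕ, ‖f n‖ = 1 / (n : ℝ) ^ 2 := by
    intro n
    rcases Nat.eq_zero_or_pos n with rfl | hn
    · simp [hf, Complex.zero_cpow hs0]
    · rw [hf, norm_div, norm_one, Complex.norm_natCast_cpow_of_pos hn, hs, Real.rpow_two]
  have hsum2 : HasSum (fun n : ℕ => 1 / (n : ℝ) ^ 2) (Real.pi ^ 2 / 6) := hasSum_zeta_two
  have hsummn : Summable fun n => ‖f n‖ := by
    simp_rw [hnorm]; exact hsum2.summable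
  have hsumm : Summable f := hsummn.of_norm
  have hf0 : f 0 = 0 := by simp [hf, Complex.zero_cpow hs0]
  have hf1 : f 1 = 1 := by simp [hf]
  have hsplit : ∑' n, f n = f 0 + (f 1 + ∑' n, f (n + 2)) := by
    rw [hsumm.tsum_eq_zero_add, ((summable_nat_add_iff 1).2 hsumm).tsum_eq_zero_add]
  rw [hsplit, hf0, hf1, zero_add, add_sub_cancel_left]
  have htail : HasSum (fun n : ℕ => 1 / ((n + 2 : ℕ) : ℝ) ^ 2) (Real.pi ^ 2 / 6 - 1) := by
    have := (hasSum_nat_add_iff' 2).2 hsum2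
    simpa [Finset.sum_range_succ] using this
  have hnorm2 : ∀ n : ℕ, ‖f (n + 2)‖ = 1 / ((n + 2 : ℕ) : ℝ) ^ 2 := fun n => hnorm (n + 2)
  have hsummn2 : Summable fun n => ‖f (n + 2)‖ := by
    simp_rw [hnorm2]; exact htail.summable
  calc ‖∑' n, f (n + 2)‖ ≤ ∑' n, ‖f (n + 2)‖ := norm_tsum_le_tsum_norm hsummn2
    _ = Real.pi ^ 2 / 6 - 1 := by simp_rw [hnorm2]; exact htail.tsum_eq

/-- On the line `Re s = 2`: `|ζ(s)| ≥ 2 − π²/6 > 1/3`. [folklore] -/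
theorem third_le_norm_zeta {s : ℂ} (hs : s.re = 2) : 1 / 3 ≤ ‖riemannZeta s‖ := by
  have h1 := norm_zeta_sub_one_le hs
  have h2 : ‖(1 : ℂ)‖ - ‖riemannZeta s‖ ≤ ‖(1 : ℂ) - riemannZeta s‖ := norm_sub_norm_le _ _
  rw [norm_one, norm_sub_rev] at h2
  have hπ : Real.pi ^ 2 / 6 - 1 ≤ 2 / 3 := by
    have := Real.pi_lt_d2
    nlinarith [Real.pi_pos]
  linarith

/-- POLYNOMIAL GROWTH LEFT OF THE STRIP, from exact identities only (functional equation at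
`s = 2 − iτ`, `|Γ(1−iτ)|² = πτ/sinh(πτ)`, `cos(π − x) = −cos x`, `cosh²(x/2) ≥ sinh(x)/2`,
`|ζ(2 − iτ)| > 1/3`): `|ζ(−1 + iτ)|² ≥ τ³/(72π³)`, so `|ζ(−1 + iτ)| ≥ 2` for `τ ≥ 30`.
[folklore] -/
theorem two_le_norm_zeta_neg_one_add {τ : ℝ} (hτ : 30 ≤ τ) :
    2 ≤ ‖riemannZeta (-1 + τ * I)‖ := by
  have hτpos : 0 < τ := by linarith
  set s : ℂ := 2 - τ * I with hsdef
  have hsre : s.re = 2 := by simp [hsdef]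
  have hs1 : s ≠ 1 := by
    intro h; have := congrArg Complex.re h; rw [hsre, one_re] at this; norm_num at this
  have hsn : ∀ n : ℕ, s ≠ -n := by
    intro n h
    have := congrArg Complex.re h
    rw [hsre, neg_re, natCast_re] at this
    linarith [n.cast_nonneg (α := ℝ)]
  have hFE := riemannZeta_one_sub hsn hs1
  have h1s : (1 : ℂ) - s = -1 + τ * I := by rw [hsdef]; ring
  rw [h1s] at hFE
  -- the four factors
  -- (1) `|(2π)^{-s}| = (2π)^{-2}`
  have hN : ‖(2 * ↑Real.pi : ℂ) ^ (-s)‖ = 1 / (2 * Real.pi) ^ 2 := by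
    rw [show (2 * ↑Real.pi : ℂ) = ((2 * Real.pi : ℝ) : ℂ) by push_cast; ring,
      Complex.norm_cpow_eq_rpow_re_of_pos (by positivity) (-s), neg_re, hsre,
      Real.rpow_neg (by positivity), Real.rpow_two, one_div]
  -- (2) `|Γ(s)| ≥ τ |Γ(1 - iτ)|`
  set A : ℝ := ‖Gamma (1 - τ * I)‖ with hA
  have hA0 : 0 ≤ A := norm_nonneg _
  have hGamma : τ * A ≤ ‖Gamma s‖ := by
    have h10 : (1 : ℂ) - τ * I ≠ 0 := by
      intro h; have := congrArg Complex.re h; simp at this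
    have : Gamma s = (1 - τ * I) * Gamma (1 - τ * I) := by
      rw [show s = (1 - τ * I) + 1 by rw [hsdef]; ring, Complex.Gamma_add_one _ h10]
    rw [this, norm_mul]
    apply mul_le_mul_of_nonneg_right _ hA0
    have := abs_im_le_norm (1 - τ * I)
    simp at this
    rwa [abs_of_pos hτpos] at this
  -- (3) `|cos(πs/2)| = cosh(πτ/2)`
  set C : ℝ := Real.cosh (Real.pi * τ / 2) with hC
  have hC0 : 0 < C := Real.cosh_pos _
  have hcos : ‖Complex.cos (↑Real.pi * s / 2)‖ = C := by
    have : ↑Real.pi * s / 2 = ↑Real.pi - ((Real.pi * τ / 2 : ℝ) : ℂ) * I := by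
      rw [hsdef]; push_cast; ring
    rw [this, Complex.cos_pi_sub, norm_neg, Complex.cos_mul_I, ← Complex.ofReal_cosh, norm_real,
      Real.norm_of_nonneg hC0.le]
  -- (4) `|ζ(s)| ≥ 1/3`
  have hZ := third_le_norm_zeta hsre
  -- assemble the lower bound `B ≥ τ A C / (6 π²)`
  set B : ℝ := ‖riemannZeta (-1 + τ * I)‖ with hB
  have hBeq : B = 2 * (1 / (2 * Real.pi) ^ 2) * ‖Gamma s‖ * C * ‖riemannZeta s‖ := by
    rw [hB, hFE, norm_mul, norm_mul, norm_mul, norm_mul, hN, hcos]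
    norm_num
  have hlow : τ * (A * C) / (6 * Real.pi ^ 2) ≤ B := by
    rw [hBeq]
    have hπ : 0 < Real.pi := Real.pi_pos
    calc τ * (A * C) / (6 * Real.pi ^ 2)
        = 2 * (1 / (2 * Real.pi) ^ 2) * (τ * A) * C * (1 / 3) := by field_simp; ring
      _ ≤ 2 * (1 / (2 * Real.pi) ^ 2) * ‖Gamma s‖ * C * ‖riemannZeta s‖ := by
          gcongr
  -- the analytic inequality `(A C)² ≥ πτ/2`
  have hAC : Real.pi * τ / 2 ≤ (A * C) ^ 2 := by
    have hkey := norm_Gamma_one_sub_mul_I_sq hτpos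
    rw [← hA] at hkey
    have hhalf : C ^ 2 = (Real.cosh (Real.pi * τ) + 1) / 2 := by
      have h1 := Real.cosh_two_mul (Real.pi * τ / 2)
      have h2 := Real.cosh_sq (Real.pi * τ / 2)
      rw [show 2 * (Real.pi * τ / 2) = Real.pi * τ by ring] at h1
      rw [hC]; nlinarith [h1, h2]
    have hsc : Real.sinh (Real.pi * τ) ≤ Real.cosh (Real.pi * τ) := (Real.sinh_lt_cosh _).le
    have hA2 : 0 ≤ A ^ 2 := sq_nonneg _
    calc Real.pi * τ / 2 = A ^ 2 * Real.sinh (Real.pi * τ) / 2 := by rw [hkey]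
      _ ≤ A ^ 2 * ((Real.cosh (Real.pi * τ) + 1) / 2) := by nlinarith
      _ = (A * C) ^ 2 := by rw [mul_pow, hhalf]
  -- numerics: `B² ≥ τ³/(72π³) ≥ 27000/(72·64) > 4`
  have hπ3 : Real.pi ^ 3 ≤ 64 := by
    have := Real.pi_le_four
    nlinarith [Real.pi_pos]
  have hτ3 : (27000 : ℝ) ≤ τ ^ 3 := by
    have := pow_le_pow_left₀ (by norm_num) hτ 3
    norm_num at this
    linarith
  have hL0 : 0 ≤ τ * (A * C) / (6 * Real.pi ^ 2) := by positivity
  have hB2 : 4 ≤ B ^ 2 := by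
    have h1 : (τ * (A * C) / (6 * Real.pi ^ 2)) ^ 2 ≤ B ^ 2 := pow_le_pow_left₀ hL0 hlow 2
    have h2 : τ ^ 2 * (Real.pi * τ / 2) / (36 * Real.pi ^ 4) ≤
        (τ * (A * C) / (6 * Real.pi ^ 2)) ^ 2 := by
      rw [div_pow, mul_pow, show (6 * Real.pi ^ 2) ^ 2 = 36 * Real.pi ^ 4 by ring]
      gcongr
    have h3 : (4 : ℝ) ≤ τ ^ 2 * (Real.pi * τ / 2) / (36 * Real.pi ^ 4) := by
      rw [le_div_iff₀ (by positivity)]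
      have hπ : 0 < Real.pi := Real.pi_pos
      -- 4·36π⁴ ≤ τ³ π / 2  ⟸  288 π³ ≤ τ³
      have : 288 * Real.pi ^ 3 ≤ τ ^ 3 := by linarith
      nlinarith [this, hπ]
    linarith
  by_contra hlt
  push Not at hlt
  have hB0 : 0 ≤ B := norm_nonneg _
  nlinarith [hB2, hlt, hB0]

/-- `ζ(−1) = −1/12` (Mathlib's Bernoulli evaluation). [folklore] -/
theorem zeta_neg_one_eq : riemannZeta (-1) = -1 / 12 := by
  have := riemannZeta_neg_nat_eq_bernoulli 1
  simp at this
  rw [this]; norm_num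

/-- WR with the LEFT-EDGE hypothesis `r < Re z − 1/2` DROPPED (discs anywhere in `{Re s < 1}`). -/
def ZetaWeakRecurrenceWithoutLeftEdge : Prop :=
  ∀ (z : ℂ) (r : ℝ), 0 < r → r < 1 - z.re → ∀ ε : ℝ, 0 < ε → ∀ T : ℝ, ∃ τ : ℝ, T ≤ τ ∧
    ∀ s ∈ Metric.closedBall z r, ‖riemannZeta (s + ↑τ * Complex.I) - riemannZeta s‖ < ε

/-- The left-edge hypothesis is load-bearing for an HONEST reason — growth: left of the critical
line `|ζ(σ + iτ)| = |χ(σ+iτ)| |ζ(1−σ−iτ)|` grows like `τ^{1/2−σ}`, so no shifted copy ever comes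
back. Witness disc `|s + 1| ≤ 1` (inside `Re s ≤ 0 < 1`), `ε = 1`, `T = 30`, evaluated at the
centre `s = −1`: `|ζ(−1+iτ)| ≥ 2 > 1 + 1/12` for every `τ ≥ 30` (`two_le_norm_zeta_neg_one_add`).
[folklore] -/
theorem zetaWeakRecurrence_false_without_leftEdge : ¬ ZetaWeakRecurrenceWithoutLeftEdge := by
  intro h
  obtain ⟨τ, hτ, hret⟩ := h (-1) 1 one_pos (by norm_num) 1 one_pos 30
  have hmem : (-1 : ℂ) ∈ closedBall (-1 : ℂ) 1 := mem_closedBall_self zero_le_one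
  have hlt := hret (-1) hmem
  have hbig := two_le_norm_zeta_neg_one_add hτ
  have hval : ‖riemannZeta (-1)‖ = 1 / 12 := by
    rw [zeta_neg_one_eq]
    norm_num
  have htri := norm_sub_norm_le (riemannZeta (-1 + τ * I)) (riemannZeta (-1))
  linarith


/-! ## §3  What any proof of WR proves: the zero-or-infinity glue -/

/-- `CofiniteCriticalLine → NoRightInteriorBand` (a finite off-line set is finite in every window that
misses the critical line; window half-width `σ₀ − 1/2`). [folklore] -/
theorem noRightInteriorBand_of_cofinite (hC : CofiniteCriticalLine) : NoRightInteriorBand := by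
  intro σ₀ h1 h2
  refine ⟨σ₀ - 1 / 2, by linarith, hC.subset ?_⟩
  rintro s ⟨hs0, hpos, hlt, habs⟩
  refine ⟨hs0, hpos, hlt, ?_⟩
  intro heq
  rw [heq, abs_lt] at habs
  linarith [habs.1]

/-- WR ⟹ the route's open glue rung `CofiniteToExact` (Bombieri's zero-or-infinity dichotomy): any proof
of WR in particular excludes the world "finitely many, but at least one, off-line zeros". (Tree Rouché
glue `exactFirstBand_of_noRightInteriorBand_of_weakRecurrence` + `Cofinite → NRIB`.) Not landed under
`Negative/` (its conclusion is a route item); recorded here. [cite: Steuding2007, Thm. 8.3 (proof)] -/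
theorem cofiniteToExact_of_zetaWeakRecurrence (hW : ZetaWeakRecurrence) : CofiniteToExact :=
  fun hC => Summit.RiemannHypothesis.RiemannHypothesis.Theorems.NribWeakRecurrenceToExact.exactFirstBand_of_noRightInteriorBand_of_weakRecurrence
    (noRightInteriorBand_of_cofinite hC) hW

/-! ## §4  Targets — the lead's stubs (`Lines/Sketch.lean`) -/

/-- TARGET CHECK: `stub_recurrence_of_approximant` is TRUE as registered (verbatim signature) — disc
universality (tree `Steuding2007_thm1_9_discAnalytic_holds`, proved) at the zero-free target `g` and
level `η`, then `‖ζ(s+iτ) − ζ(s)‖ ≤ ‖ζ(s+iτ) − g(s)‖ + ‖g(s) − ζ(s)‖ < η + (ε − η)`; a set of positive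
lower density is unbounded above. Not misstated, not vacuous. [cite: Steuding2007, Thm. 1.9] -/
theorem stub_recurrence_of_approximant_holds :
    ∀ (z : ℂ) (r : ℝ), 0 < r → r < min (z.re - 1 / 2) (1 - z.re) → ∀ ε : ℝ, 0 < ε →
      (∃ (R η : ℝ) (g : ℂ → ℂ), r < R ∧ 0 < η ∧ DifferentiableOn ℂ g (Metric.ball z R) ∧
        (∀ s ∈ Metric.closedBall z r, g s ≠ 0) ∧
        ∀ s ∈ Metric.closedBall z r, ‖riemannZeta s - g s‖ ≤ ε - η) →
      ∀ T : ℝ, ∃ τ : ℝ, T ≤ τ ∧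
        ∀ s ∈ Metric.closedBall z r, ‖riemannZeta (s + ↑τ * Complex.I) - riemannZeta s‖ < ε := by
  intro z r hr hrmin ε hε hA T
  obtain ⟨R, η, g, hrR, hη, hg, hg0, hclose⟩ := hA
  have hr1 : 1 / 2 < z.re - r := by
    have := hrmin.trans_le (min_le_left _ _); linarith
  have hr2 : z.re + r < 1 := by
    have := hrmin.trans_le (min_le_right _ _); linarith
  obtain ⟨δ, hδ, T₀, hT₀⟩ :=
    Literature.NumberTheory.LFunctions.Steuding2007_thm1_9_discAnalytic_holds z r R hr hrR hr1 hr2 g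
      hg hg0 η hη
  have hpos : HasPosLowerDensity
      {τ : ℝ | ∀ s ∈ closedBall z r, ‖riemannZeta (s + τ * I) - g s‖ < η} := ⟨δ, hδ, T₀, hT₀⟩
  obtain ⟨τ, hτ, hTτ⟩ := hpos.exists_gt T
  refine ⟨τ, hTτ.le, fun s hs => ?_⟩
  calc ‖riemannZeta (s + τ * I) - riemannZeta s‖
      ≤ ‖riemannZeta (s + τ * I) - g s‖ + ‖g s - riemannZeta s‖ :=
        norm_sub_le_norm_sub_add_norm_sub _ _ _
    _ < η + (ε - η) := add_lt_add_of_lt_of_le (hτ s hs) (by rw [norm_sub_rev]; exact hclose s hs)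
    _ = ε := by ring

/-- TARGET CHECK: `stub_approximant_of_noInteriorZero` is TRUE as registered (verbatim signature): the
contraction `g(s) = ζ(z + (1 − θ)(s − z))`, `θ = min (1/2, δ₀/2r)` with `δ₀` a modulus of uniform
continuity of `ζ` on the compact disc at level `ε/2`, is holomorphic on `|s − z| < 1 − Re z`, zero-free on
the closed disc (its argument stays in the OPEN disc `|w − z| ≤ (1−θ)r < r`), and `(ε/2)`-close to `ζ`
(`|s − w| = θ|s − z| ≤ θr < δ₀`). Not misstated, not vacuous. [folklore] -/
theorem stub_approximant_of_noInteriorZero_holds :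
    ∀ (z : ℂ) (r : ℝ), 0 < r → r < min (z.re - 1 / 2) (1 - z.re) →
      (∀ s ∈ Metric.ball z r, riemannZeta s ≠ 0) → ∀ ε : ℝ, 0 < ε →
      ∃ (R η : ℝ) (g : ℂ → ℂ), r < R ∧ 0 < η ∧ DifferentiableOn ℂ g (Metric.ball z R) ∧
        (∀ s ∈ Metric.closedBall z r, g s ≠ 0) ∧
        ∀ s ∈ Metric.closedBall z r, ‖riemannZeta s - g s‖ ≤ ε - η := by
  intro z r hr hrmin hno ε hε
  have hr2 : r < 1 - z.re := hrmin.trans_le (min_le_right _ _)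
  -- uniform continuity of `ζ` on the compact disc
  have hcont : ContinuousOn riemannZeta (closedBall z r) := by
    intro s hs
    have hs1 : s ≠ 1 := by
      intro h1
      rw [h1, mem_closedBall, dist_eq_norm] at hs
      have h2 := (abs_re_le_norm ((1 : ℂ) - z)).trans hs
      rw [sub_re, one_re, abs_le] at h2
      linarith [h2.2]
    exact (differentiableAt_riemannZeta hs1).continuousAt.continuousWithinAt
  have huc := (isCompact_closedBall z r).uniformContinuousOn_of_continuous hcont
  rw [Metric.uniformContinuousOn_iff] at huc
  obtain ⟨δ₀, hδ₀, hδ⟩ := huc (ε / 2) (by positivity)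
  -- the contraction ratio
  set θ : ℝ := min (1 / 2) (δ₀ / (2 * r)) with hθ
  have hθpos : 0 < θ := lt_min (by norm_num) (by positivity)
  have hθlt : θ < 1 := (min_le_left _ _).trans_lt (by norm_num)
  have hθr : θ * r < δ₀ := by
    have h1 : θ ≤ δ₀ / (2 * r) := min_le_right _ _
    calc θ * r ≤ δ₀ / (2 * r) * r := by gcongr
      _ = δ₀ / 2 := by field_simp
      _ < δ₀ := by linarith
  have hnorm1θ : ‖(1 - (θ : ℂ))‖ = 1 - θ := by
    rw [show (1 - (θ : ℂ)) = ((1 - θ : ℝ) : ℂ) by push_cast; ring, norm_real,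
      Real.norm_of_nonneg (by linarith)]
  have hnormθ : ‖(θ : ℂ)‖ = θ := by rw [norm_real, Real.norm_of_nonneg hθpos.le]
  -- the contracted argument stays in the open disc
  have hwmem : ∀ s ∈ closedBall z r, z + (1 - (θ : ℂ)) * (s - z) ∈ ball z r := by
    intro s hs
    rw [mem_closedBall, dist_eq_norm] at hs
    rw [mem_ball, dist_eq_norm, add_sub_cancel_left, norm_mul, hnorm1θ]
    calc (1 - θ) * ‖s - z‖ ≤ (1 - θ) * r := by gcongr
      _ < r := by nlinarith
  refine ⟨1 - z.re, ε / 2, fun s => riemannZeta (z + (1 - (θ : ℂ)) * (s - z)), hr2, by positivity,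
    ?_, ?_, ?_⟩
  · -- holomorphic on `|s - z| < 1 - Re z` (the argument has real part `< 1`)
    intro s hs
    have hw1 : z + (1 - (θ : ℂ)) * (s - z) ≠ 1 := by
      intro h1
      rw [mem_ball, dist_eq_norm] at hs
      have hre := congrArg Complex.re h1
      have h2 : (s - z).re ≤ ‖s - z‖ := (le_abs_self _).trans (abs_re_le_norm _)
      simp only [add_re, mul_re, sub_re, one_re, ofReal_re, sub_im, ofReal_im, one_im, sub_self,
        zero_mul, sub_zero] at hre
      rw [sub_re] at h2
      nlinarith [h2, hθpos, hθlt, hs, hr2]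
    exact ((differentiableAt_riemannZeta hw1).comp s (by fun_prop)).differentiableWithinAt
  · -- zero-free on the closed disc
    intro s hs
    exact hno _ (hwmem s hs)
  · -- `(ε/2)`-close to `ζ` on the closed disc
    intro s hs
    have hw := hwmem s hs
    have hd : dist s (z + (1 - (θ : ℂ)) * (s - z)) < δ₀ := by
      rw [dist_eq_norm, show s - (z + (1 - (θ : ℂ)) * (s - z)) = (θ : ℂ) * (s - z) by ring, norm_mul,
        hnormθ]
      rw [mem_closedBall, dist_eq_norm] at hs
      calc θ * ‖s - z‖ ≤ θ * r := by gcongr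
        _ < δ₀ := hθr
    have h := hδ s hs _ (ball_subset_closedBall hw) hd
    rw [dist_eq_norm] at h
    linarith

/-! ### Near-misses / not typed (see the docblock §1–§2 for why)
* sharp left-edge tightness at the critical line (needs Stirling for `|χ|` + an RH-strength min-modulus bound);
* recurrence on discs of `{Re s > 1/2}` crossing `Re s = 1` away from the pole (expected TRUE);
* WR-shape for Beurling zetas with finitely many planted off-line zeros (FALSE by Rouché; abstract-model
  negative, tree `BeurlingCounterexamples` template too heavy for this cycle);
* integer-shift WR (Reich's discrete universality not in tree).
-/

end Summit.RiemannHypothesis.RiemannHypothesis.Cruxes.ZetaWeakRecurrence.Disproof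

end
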